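import Literature.AlgebraicTopology.SingularHomology.FiniteCoverTransfer
import Literature.AlgebraicGeometry.HodgeTheory.RealStructureSingular
import HarnessLib

/-!
# Rationality of a complex class descends along a finite covering

For a finite covering `p : E → B` (the tree's `IsFiniteCover`, Hatcher §3.G: a covering map, onto, with
finite fibres) the NORMALISED transfer `τ : Hⁿ(E; R) → Hⁿ(B; R)` (`IsFiniteCover.transferMap`,
`(τψ)(σ) = (#lifts σ)⁻¹ Σ_{σ̃ ↦ σ} ψ(σ̃)`, any commutative `ℚ`-algebra `R`) is a retraction of `p^*`
(`IsFiniteCover.transferMap_map`). PROVED here (theorems only; no definition, no named fact):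

* `ofRatClass_transferMap_isFiniteCover` — the transfer COMMUTES WITH THE RATIONAL LATTICE
  `Hⁿ(–; ℚ) → Hⁿ(–; ℂ)` (`HodgeTheory.ofRatClass`): `τ_ℂ (y ⊗ 1) = (τ_ℚ y) ⊗ 1` — both are computed on
  cochains, and `ℚ → ℂ` is a ring map carrying the weight `(#lifts σ)⁻¹ ∈ ℚ` to the weight in `ℂ`;
* `IsRationalClass.transferMap_isFiniteCover` — hence `τ_ℂ` carries rational classes to rational classes;
* **`IsRationalClass.of_map_isFiniteCover`** — if `p^* x ∈ Hⁿ(E; ℂ)` is rational then so is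
  `x ∈ Hⁿ(B; ℂ)`: `x = τ_ℂ (p^* x)` is the transfer of a rational class.

This is the elementary half of Hatcher's Prop. 3G.1 («`π^*` is injective with image the invariant classes»,
coefficients of characteristic `0`) in the form needed to descend the rationality of a Kähler class along the
level coverings of a tower of compact ball quotients (consumer: fan A of the `hodgecm-mathlib` cell, junction
«Matsushima at the pin», the tower Kähler class system of the Picard modular surfaces).

## References

* [HatcherAT2002] A. Hatcher, *Algebraic Topology*, CUP 2002, §3.G p. 321 and Prop. 3G.1; §3.1 p. 198
  (change of coefficients).
-/

noncomputable section

open CategoryTheory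

universe u

namespace Literature.AlgebraicGeometry.HodgeTheory

section HodgeTheory

open Literature.AlgebraicTopology.SingularHomology singularCochainComplex IsFiniteCover

-- the cochain modules of `singularCochainComplex` are function types up to unfolding
set_option backward.isDefEq.respectTransparency false

variable {E B : Type u} [TopologicalSpace E] [TopologicalSpace B] {proj : C(E, B)}
  (c : IsFiniteCover proj) {n : ℕ}

/-- The weight `(#lifts σ)⁻¹` read in `ℂ` is the image of the weight read in `ℚ`. [folklore] -/
private theorem ratCast_weight_isFiniteCover (σ : SingularSimplex B n) :
    ((c.weight (R := ℚ) σ : ℚ) : ℂ) = c.weight (R := ℂ) σ := by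
  simp [weight]

/-- **The normalised transfer commutes with the rational lattice**: `τ_ℂ (y ⊗ 1) = (τ_ℚ y) ⊗ 1` for
`y ∈ Hⁿ(E; ℚ)` (both sides are `[σ ↦ (#lifts σ)⁻¹ Σ_{σ̃ ↦ σ} ζ(σ̃)]` for a cocycle `ζ` representing `y`).
[cite: HatcherAT2002, §3.G p. 321; §3.1 p. 198] -/
theorem ofRatClass_transferMap_isFiniteCover (y : singularCohomology ℚ ℚ E n) :
    ofRatClass B n (c.transferMap (R := ℚ) n y) = c.transferMap (R := ℂ) n (ofRatClass E n y) := by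
  induction y using singularCohomology_induction_on with
  | h ζ =>
    have hL : c.transferMap (R := ℚ) n (singularCohomology.π ℚ ℚ E n ζ) =
        singularCohomology.π ℚ ℚ B n (HomologicalComplex.cyclesMap (c.transfer (R := ℚ)) n ζ) := by
      change ((singularCochainComplex ℚ ℚ E).homologyπ n ≫
        HomologicalComplex.homologyMap (c.transfer (R := ℚ)) n) ζ =
        (HomologicalComplex.cyclesMap (c.transfer (R := ℚ)) n ≫ (singularCochainComplex ℚ ℚ B).homologyπ n) ζ
      rw [HomologicalComplex.homologyπ_naturality]
    have hR : c.transferMap (R := ℂ) n (singularCohomology.π ℂ ℂ E n (cocycleOfRat E n ζ)) =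
        singularCohomology.π ℂ ℂ B n
          (HomologicalComplex.cyclesMap (c.transfer (R := ℂ)) n (cocycleOfRat E n ζ)) := by
      change ((singularCochainComplex ℂ ℂ E).homologyπ n ≫
        HomologicalComplex.homologyMap (c.transfer (R := ℂ)) n) (cocycleOfRat E n ζ) =
        (HomologicalComplex.cyclesMap (c.transfer (R := ℂ)) n ≫ (singularCochainComplex ℂ ℂ B).homologyπ n)
          (cocycleOfRat E n ζ)
      rw [HomologicalComplex.homologyπ_naturality]
    rw [hL, ofRatClass_π, ofRatClass_π, hR]
    refine congrArg _ (cocycles_ext ?_)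
    have h1 : iCocycles ℂ ℂ B n (cocycleOfRat B n (HomologicalComplex.cyclesMap (c.transfer (R := ℚ)) n ζ)) =
        coeffCochain (R := ℚ) (S := ℂ) (Rat.castHom ℂ).toAddMonoidHom n
          ((c.transfer (R := ℚ)).f n (iCocycles ℚ ℚ E n ζ)) := by
      rw [cocycleOfRat_eq_coeffCocycle, iCocycles_coeffCocycle]
      congr 1
      change (HomologicalComplex.cyclesMap (c.transfer (R := ℚ)) n ≫ iCocycles ℚ ℚ B n) ζ = _
      rw [HomologicalComplex.cyclesMap_i]
      rfl
    have h2 : iCocycles ℂ ℂ B n (HomologicalComplex.cyclesMap (c.transfer (R := ℂ)) n (cocycleOfRat E n ζ)) =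
        (c.transfer (R := ℂ)).f n
          (coeffCochain (R := ℚ) (S := ℂ) (Rat.castHom ℂ).toAddMonoidHom n (iCocycles ℚ ℚ E n ζ)) := by
      change (HomologicalComplex.cyclesMap (c.transfer (R := ℂ)) n ≫ iCocycles ℂ ℂ B n) (cocycleOfRat E n ζ) = _
      rw [HomologicalComplex.cyclesMap_i]
      change (c.transfer (R := ℂ)).f n (iCocycles ℂ ℂ E n (cocycleOfRat E n ζ)) = _
      rw [cocycleOfRat_eq_coeffCocycle, iCocycles_coeffCocycle]
    rw [h1, h2]
    refine singularCochainComplex.ext fun σ ↦ ?_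
    rw [coeffCochain_apply, transfer_f_apply, transfer_f_apply]
    change ((c.weight (R := ℚ) σ * ∑ a ∈ c.liftsFinset σ, iCocycles ℚ ℚ E n ζ a : ℚ) : ℂ) = _
    rw [Rat.cast_mul, Rat.cast_sum, ratCast_weight_isFiniteCover c]
    rfl

/-- The normalised transfer carries rational classes to rational classes. [cite: HatcherAT2002, §3.G p. 321] -/
theorem IsRationalClass.transferMap_isFiniteCover {y : singularCohomology ℂ ℂ E n} (hy : IsRationalClass y) :
    IsRationalClass (c.transferMap (R := ℂ) n y) := by
  obtain ⟨a, rfl⟩ := (isRationalClass_iff_mem_range_ofRatClass y).1 hy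
  rw [← ofRatClass_transferMap_isFiniteCover c]
  exact isRationalClass_ofRatClass _

include c in
/-- **Rationality descends along a finite covering**: if `p^* x` is a rational class of `E`, then `x` is a
rational class of `B` (`x = τ (p^* x)`, Hatcher's `τ^* π^* = 1` after normalisation, and `τ` preserves the
rational lattice). [cite: HatcherAT2002, §3.G p. 321 and Prop. 3G.1] -/
theorem IsRationalClass.of_map_isFiniteCover {x : singularCohomology ℂ ℂ B n}
    (hx : IsRationalClass (singularCohomology.map ℂ ℂ proj n x)) : IsRationalClass x := by
  rw [← c.transferMap_map n x]
  exact IsRationalClass.transferMap_isFiniteCover c hx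

end HodgeTheory

end Literature.AlgebraicGeometry.HodgeTheory

end
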